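import Summits.ValiantsHypothesis.ValiantsHypothesis.Theorems.KPlusLogSqLawWeakLiftingTowerGraftTwoSidedExchangeSplit
import Summits.ValiantsHypothesis.ValiantsHypothesis.Theorems.KPlusLogSqLawWeakLiftingTowerGraftTwoSidedClusteredLower

/-!
# Tower graft line — THE MIRROR EXCHANGE LAW: PSD letters BELOW the pivot at lower gaps that are multiples of the top gap

Crux `stmt-ValiantsHypothesis-19561` (`WeakLifting`), line (B) `tower_graft`, two-sided word instrument; seat val-sym-lift-p3 g21,
`--supports 19561`, NO stub claimed.  Reflection (`t ↦ 1/t`) of `…TwoSidedExchangeSplit` / `…TwoSidedCommensurable`, in the census currency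
of `…TwoSidedClusteredLower` (exponent vector `Matrix.vecCons (d₀+a+b) (Matrix.vecCons (d₀+a) (fun l => d₀ + γ l))`, letters
`Matrix.vecCons C (Matrix.vecCons J P)`): word `Σₗ X^{d₀+γₗ} Pₗ + X^{d₀+a} J + X^{d₀+a+b} C` with `C ≻ 0` on top, `J` ANY symmetric just
below it, ANY NUMBER of PSD letters `Pₗ` below the pivot whose gaps to the pivot are MULTIPLES of the top gap, `γₗ + b·qₗ = a`, `qₗ ≥ 1`
(no clustering: `qₗ = 1` for all `l` is the clustered case of `…ClusteredLower`):
* `card_posType_le_rank_commensurable_lower` — exiting-type kernel pairs `≤ rank C + Σₗ qₗ·rank Pₗ`;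
* `card_posType_roots_le_commensurable_lower` (census form) and ★ `card_posRoots_le_commensurable_lower`: with a positive definite bottom
  letter and simple crossings, `Z₊ ≤ 2(m + m Σₗ qₗ)` with multiplicity.
HONEST FRAMING: a structural, m-linear law whose constant grows with the gaps — not a tower graft law; nothing on S4…S5, `TowerB`,
`WeakLifting` in its window, Conjecture B, 18050 or `VP ≠ VNP`.  Def-free.

[folklore] exchange certificates + the inertia kit's global index formula.
-/

set_option linter.dupNamespace false
set_option autoImplicit false

namespace Summit.ValiantsHypothesis.ValiantsHypothesis.Theorems.KPlusLogSqLaw.TowerGraft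

open Matrix
open scoped BigOperators

namespace TwoSidedThree

/-! ## §1 The mirror exchange law: PSD letters BELOW the pivot at lower gaps that are MULTIPLES of the top gap -/

section CommensurableLowerAll

variable {m : ℕ} {I : Type} [Fintype I] [DecidableEq I] {L : ℕ}
variable (C J : Matrix (Fin m) (Fin m) ℝ) (P : Fin L → Matrix (Fin m) (Fin m) ℝ) (a b : ℕ) (γ q : Fin L → ℕ)
  (τ : I → ℝ) (u : I → Fin m → ℝ)

/-- **THE MIRROR EXCHANGE LAW (kernel).**  Word `Σₗ τ^{γₗ} Pₗ + τ^a J + τ^{a+b} C` with `Pₗ ⪰ 0` BELOW the pivot, `C ⪰ 0` on top, `J` ANY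
symmetric, and every lower gap a MULTIPLE of the top gap: `a − γₗ = b·qₗ`, `qₗ ≥ 1` (e.g. every support `(d₁, …, d_{K−2}, D−1, D)`).  Then
the kernel pairs of POSITIVE (exiting) type at distinct positive scales number at most `rank C + Σₗ qₗ·rank Pₗ` — reflection `τ ↦ 1/τ` of
`card_negType_le_rank_commensurable`. [folklore] -/
theorem card_posType_le_rank_commensurable_lower (hC : C.PosSemidef) (hJ : J.IsSymm) (hP : ∀ l, (P l).PosSemidef)
    (hτ : ∀ i, 0 < τ i) (hinj : Function.Injective τ) (hb : 0 < b) (hq : ∀ l, 1 ≤ q l) (hγ : ∀ l, γ l + b * q l = a)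
    (hker : ∀ i, (∑ l, τ i ^ γ l • P l + τ i ^ a • J + τ i ^ (a + b) • C) *ᵥ u i = 0)
    (htype : ∀ i, ∑ l, ((a - γ l : ℕ) : ℝ) * τ i ^ γ l * (u i ⬝ᵥ (P l *ᵥ u i)) < b * τ i ^ (a + b) * (u i ⬝ᵥ (C *ᵥ u i))) :
    Fintype.card I ≤ C.rank + ∑ l, q l * (P l).rank := by
  classical
  refine card_negType_le_rank_commensurable C J P b (fun l => a + b - γ l) q (fun i => (τ i)⁻¹) u hC hJ hP
    (fun i => inv_pos.mpr (hτ i)) (fun i k hik => hinj (inv_injective hik)) hb hq ?_ ?_ ?_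
  · intro l; have := hγ l; have := hq l
    have : a + b - γ l = b * (q l + 1) := by rw [Nat.mul_succ]; omega
    exact this
  · intro i
    have hτi : τ i ≠ 0 := ne_of_gt (hτ i)
    have h := congrArg (fun w => ((τ i)⁻¹) ^ (a + b) • w) (hker i)
    simp only [smul_zero] at h
    rw [← h, ← Matrix.smul_mulVec]
    congr 1
    have e1 : ∀ l, (τ i)⁻¹ ^ (a + b) * τ i ^ γ l = (τ i)⁻¹ ^ (a + b - γ l) := by
      intro l
      have hl : γ l ≤ a + b := by have := hγ l; omega
      obtain ⟨r, hr⟩ := Nat.exists_eq_add_of_le hl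
      rw [hr, Nat.add_sub_cancel_left, pow_add, mul_comm ((τ i)⁻¹ ^ γ l), mul_assoc, ← mul_pow, inv_mul_cancel₀ hτi,
        one_pow, mul_one]
    have e2 : (τ i)⁻¹ ^ (a + b) * τ i ^ a = (τ i)⁻¹ ^ b := by
      rw [pow_add, mul_assoc, mul_comm ((τ i)⁻¹ ^ b), ← mul_assoc, ← mul_pow, inv_mul_cancel₀ hτi, one_pow, one_mul]
    have e3 : (τ i)⁻¹ ^ (a + b) * τ i ^ (a + b) = 1 := by
      rw [← mul_pow, inv_mul_cancel₀ hτi, one_pow]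
    rw [smul_add, smul_add, Finset.smul_sum, smul_smul, smul_smul, e2, e3, one_smul]
    have hs : (∑ l, (τ i)⁻¹ ^ (a + b) • (τ i ^ γ l • P l)) = ∑ l, (τ i)⁻¹ ^ (a + b - γ l) • P l :=
      Finset.sum_congr rfl fun l _ => by rw [smul_smul, e1 l]
    rw [hs]
    abel
  · intro i
    have hτi := hτ i
    have ht := htype i
    have hpow : 0 < (τ i)⁻¹ ^ (a + b) := pow_pos (inv_pos.mpr hτi) _
    have h1 := mul_lt_mul_of_pos_left ht hpow
    have e3 : (τ i)⁻¹ ^ (a + b) * τ i ^ (a + b) = 1 := by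
      rw [← mul_pow, inv_mul_cancel₀ (ne_of_gt hτi), one_pow]
    have e0 : (τ i)⁻¹ ^ (a + b) * ((b : ℝ) * τ i ^ (a + b) * (u i ⬝ᵥ (C *ᵥ u i))) = b * (u i ⬝ᵥ (C *ᵥ u i)) := by
      rw [show (τ i)⁻¹ ^ (a + b) * ((b : ℝ) * τ i ^ (a + b) * (u i ⬝ᵥ (C *ᵥ u i)))
          = ((τ i)⁻¹ ^ (a + b) * τ i ^ (a + b)) * ((b : ℝ) * (u i ⬝ᵥ (C *ᵥ u i))) by ring, e3, one_mul]
    have e1 : (τ i)⁻¹ ^ (a + b) * ∑ l, ((a - γ l : ℕ) : ℝ) * τ i ^ γ l * (u i ⬝ᵥ (P l *ᵥ u i))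
        = ∑ l, ((a + b - γ l - b : ℕ) : ℝ) * (τ i)⁻¹ ^ (a + b - γ l) * (u i ⬝ᵥ (P l *ᵥ u i)) := by
      rw [Finset.mul_sum]
      refine Finset.sum_congr rfl fun l _ => ?_
      have hl : γ l ≤ a + b := by have := hγ l; omega
      have hab : a + b - γ l - b = a - γ l := by have := hγ l; omega
      obtain ⟨r, hr⟩ := Nat.exists_eq_add_of_le hl
      have er : a + b - γ l = r := by omega
      rw [hab, er]
      have epow : (τ i)⁻¹ ^ (a + b) * τ i ^ γ l = (τ i)⁻¹ ^ r := by
        rw [hr, pow_add, mul_assoc, mul_comm ((τ i)⁻¹ ^ r), ← mul_assoc, ← mul_pow, inv_mul_cancel₀ (ne_of_gt hτi),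
          one_pow, one_mul]
      rw [← epow]; ring
    rw [e0, e1] at h1
    exact h1

end CommensurableLowerAll

/-! ## §2 Census currency: the mirror linear law, any number of lower letters -/

section CommensurableLowerCensus

open Polynomial
open Summit.ValiantsHypothesis.ValiantsHypothesis.Theorems.LacunarySymmetroidMatrixDescartes

variable {m L : ℕ}

/-- **exiting-type roots number at most `rank C + Σₗ qₗ rank Pₗ`** for the word `Σₗ X^{d₀+γₗ} Pₗ + X^{d₀+a} J + X^{d₀+a+b} C` with
`γₗ + b qₗ = a`, `qₗ ≥ 1` (census currency of `…TwoSidedClusteredLower`). [folklore] -/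
theorem card_posType_roots_le_commensurable_lower (C J : Matrix (Fin m) (Fin m) ℝ) (P : Fin L → Matrix (Fin m) (Fin m) ℝ)
    (hC : C.PosSemidef) (hJ : J.IsSymm) (hP : ∀ l, (P l).PosSemidef) (d₀ a b : ℕ) (γ q : Fin L → ℕ) (hb : 0 < b)
    (hq : ∀ l, 1 ≤ q l) (hγ : ∀ l, γ l + b * q l = a) (T : Finset ℝ) (hT : ∀ t ∈ T, 0 < t)
    (hroot : ∀ t ∈ T, ∃ u : Fin m → ℝ,
      (∑ k : Fin (L + 2), t ^ (Matrix.vecCons (d₀ + a + b) (Matrix.vecCons (d₀ + a) fun l => d₀ + γ l) k) •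
        (Matrix.vecCons C (Matrix.vecCons J P) k)) *ᵥ u = 0 ∧
      0 < (derivative (∑ k : Fin (L + 2), Polynomial.C (u ⬝ᵥ ((Matrix.vecCons C (Matrix.vecCons J P) k) *ᵥ u)) *
        (X : ℝ[X]) ^ (Matrix.vecCons (d₀ + a + b) (Matrix.vecCons (d₀ + a) fun l => d₀ + γ l) k))).eval t) :
    T.card ≤ C.rank + ∑ l, q l * (P l).rank := by
  classical
  choose! u hu using hroot
  have hγle : ∀ l, γ l ≤ a := fun l => by have := hγ l; omega
  have h := card_posType_le_rank_commensurable_lower (I := T) C J P a b γ q (fun t => (t : ℝ)) (fun t => u t) hC hJ hP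
    (fun t => hT t t.2) Subtype.coe_injective hb hq hγ
    (fun t => reduced_kernel_clustered_lower C J P d₀ a b γ (hT t t.2) _ (hu t t.2).1) ?_
  · simpa using h
  · intro t
    have ht := hT t t.2
    have hpos := (hu t t.2).2
    have heq := rayleigh_deriv_eq_clustered_lower C J P d₀ a b γ hγle ht _ (hu t t.2).1
    have h1 : 0 < (t : ℝ) * (derivative (∑ k : Fin (L + 2),
        Polynomial.C (u t ⬝ᵥ ((Matrix.vecCons C (Matrix.vecCons J P) k) *ᵥ u t)) *
        (X : ℝ[X]) ^ (Matrix.vecCons (d₀ + a + b) (Matrix.vecCons (d₀ + a) fun l => d₀ + γ l) k))).eval (t : ℝ) :=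
      mul_pos ht hpos
    rw [heq] at h1
    have h2 : 0 < (t : ℝ) ^ d₀ := pow_pos ht _
    have h3 : 0 < (b : ℝ) * (t : ℝ) ^ (a + b) * (u t ⬝ᵥ (C *ᵥ u t))
        - ∑ l, ((a - γ l : ℕ) : ℝ) * (t : ℝ) ^ γ l * (u t ⬝ᵥ (P l *ᵥ u t)) := by
      by_contra hcon
      push Not at hcon
      have := mul_nonpos_of_nonneg_of_nonpos h2.le hcon
      linarith
    linarith

/-- **THE MIRROR LINEAR LAW (simple crossings).**  `C ≻ 0` at the top exponent `d₀ + a + b`, `J` ANY symmetric at `d₀ + a` (`b ≥ 1`),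
ANY NUMBER of positive semidefinite letters `Pₗ` BELOW the pivot at `d₀ + γₗ` with every lower gap a multiple of the top gap
(`γₗ + b qₗ = a`, `qₗ ≥ 1`), among them a positive definite bottom letter `P_{l₀}` (`q_{l} < q_{l₀}` for `l ≠ l₀`, i.e. a unique lowest
exponent — merge tied bottom letters first).  If every positive root of `det F` is a simple crossing then `det F` has at most
`2(m + m Σₗ qₗ)` positive roots counted with multiplicity (`card_posType_roots_le_commensurable_lower` + `Inertia.global_index_formula`,
`ν(P_{l₀}) = ν(C) = 0`).  Mirror of `card_posRoots_le_commensurable`; not a tower graft law (the constant grows with the gaps). [folklore] -/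
theorem card_posRoots_le_commensurable_lower (C J : Matrix (Fin m) (Fin m) ℝ) (P : Fin L → Matrix (Fin m) (Fin m) ℝ)
    (hC : C.PosDef) (hJ : J.IsSymm) (hP : ∀ l, (P l).PosSemidef) (l₀ : Fin L) (hbot : (P l₀).PosDef)
    (d₀ a b : ℕ) (γ q : Fin L → ℕ) (hb : 0 < b) (hq : ∀ l, 1 ≤ q l) (hγ : ∀ l, γ l + b * q l = a)
    (hqbot : ∀ l, l ≠ l₀ → q l < q l₀)
    (hcorank : ∀ t : ℝ, 0 < t →
      (∑ k : Fin (L + 2), t ^ (Matrix.vecCons (d₀ + a + b) (Matrix.vecCons (d₀ + a) fun l => d₀ + γ l) k) •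
        (Matrix.vecCons C (Matrix.vecCons J P) k)).det = 0 →
      (∑ k : Fin (L + 2), t ^ (Matrix.vecCons (d₀ + a + b) (Matrix.vecCons (d₀ + a) fun l => d₀ + γ l) k) •
        (Matrix.vecCons C (Matrix.vecCons J P) k)).rank + 1 = m)
    (htype : ∀ t : ℝ, 0 < t →
      (∑ k : Fin (L + 2), t ^ (Matrix.vecCons (d₀ + a + b) (Matrix.vecCons (d₀ + a) fun l => d₀ + γ l) k) •
        (Matrix.vecCons C (Matrix.vecCons J P) k)).det = 0 →
      (∀ u : Fin m → ℝ, (∑ k : Fin (L + 2), t ^ (Matrix.vecCons (d₀ + a + b) (Matrix.vecCons (d₀ + a) fun l => d₀ + γ l) k) •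
          (Matrix.vecCons C (Matrix.vecCons J P) k)) *ᵥ u = 0 → u ≠ 0 →
        (derivative (∑ k : Fin (L + 2), Polynomial.C (u ⬝ᵥ ((Matrix.vecCons C (Matrix.vecCons J P) k) *ᵥ u)) *
          (X : ℝ[X]) ^ (Matrix.vecCons (d₀ + a + b) (Matrix.vecCons (d₀ + a) fun l => d₀ + γ l) k))).eval t < 0) ∨
      (∀ u : Fin m → ℝ, (∑ k : Fin (L + 2), t ^ (Matrix.vecCons (d₀ + a + b) (Matrix.vecCons (d₀ + a) fun l => d₀ + γ l) k) •
          (Matrix.vecCons C (Matrix.vecCons J P) k)) *ᵥ u = 0 → u ≠ 0 →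
        0 < (derivative (∑ k : Fin (L + 2), Polynomial.C (u ⬝ᵥ ((Matrix.vecCons C (Matrix.vecCons J P) k) *ᵥ u)) *
          (X : ℝ[X]) ^ (Matrix.vecCons (d₀ + a + b) (Matrix.vecCons (d₀ + a) fun l => d₀ + γ l) k))).eval t)) :
    Multiset.card ((Matrix.det (∑ k : Fin (L + 2),
        ((X : ℝ[X]) ^ (Matrix.vecCons (d₀ + a + b) (Matrix.vecCons (d₀ + a) fun l => d₀ + γ l) k)) •
          (Matrix.vecCons C (Matrix.vecCons J P) k).map Polynomial.C)).roots.filter (fun t => 0 < t))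
      ≤ 2 * (m + m * ∑ l, q l) := by
  classical
  set dv : Fin (L + 2) → ℕ := Matrix.vecCons (d₀ + a + b) (Matrix.vecCons (d₀ + a) fun l => d₀ + γ l) with hdv
  set Sv : Fin (L + 2) → Matrix (Fin m) (Fin m) ℝ := Matrix.vecCons C (Matrix.vecCons J P) with hSv
  have hCs : C.IsSymm := by
    have h1 := hC.1; unfold Matrix.IsHermitian at h1
    rwa [Matrix.conjTranspose_eq_transpose_of_trivial] at h1
  have hPs : ∀ l, (P l).IsSymm := by
    intro l; have h1 := (hP l).1; unfold Matrix.IsHermitian at h1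
    rwa [Matrix.conjTranspose_eq_transpose_of_trivial] at h1
  have hS : ∀ k, (Sv k).IsSymm := by
    intro k
    refine Fin.cases ?_ (fun k => ?_) k
    · simpa [hSv] using hCs
    · refine Fin.cases ?_ (fun l => ?_) k
      · simpa [hSv] using hJ
      · simpa [hSv] using hPs l
  have hdv0 : dv 0 = d₀ + a + b := by simp [hdv]
  have hdv1 : dv 1 = d₀ + a := by simp [hdv]
  have hdvl : ∀ l : Fin L, dv l.succ.succ = d₀ + γ l := by intro l; simp [hdv]
  have hγlt : ∀ l, γ l < a := by
    intro l; have := hγ l; have := hq l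
    have : b * 1 ≤ b * q l := Nat.mul_le_mul_left b (hq l)
    omega
  have hγbot : ∀ l, l ≠ l₀ → γ l₀ < γ l := by
    intro l hl
    have h1 := hγ l; have h2 := hγ l₀
    have h3 : b * q l < b * q l₀ := Nat.mul_lt_mul_of_pos_left (hqbot l hl) hb
    omega
  have hmin : ∀ k : Fin (L + 2), k ≠ l₀.succ.succ → dv l₀.succ.succ < dv k := by
    intro k hk
    rw [hdvl l₀]
    revert hk
    refine Fin.cases ?_ (fun k => ?_) k
    · intro _; rw [hdv0]; have := hγlt l₀; omega
    · refine Fin.cases ?_ (fun l => ?_) k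
      · intro _; show d₀ + γ l₀ < dv 1; rw [hdv1]; have := hγlt l₀; omega
      · intro hne
        rw [hdvl]
        have hl : l ≠ l₀ := fun h => hne (by rw [h])
        have := hγbot l hl
        omega
  have hmax : ∀ k : Fin (L + 2), k ≠ 0 → dv k < dv 0 := by
    intro k hk
    rw [hdv0]
    revert hk
    refine Fin.cases ?_ (fun k => ?_) k
    · intro h; exact absurd rfl h
    · intro _
      refine Fin.cases ?_ (fun l => ?_) k
      · show dv 1 < d₀ + a + b; rw [hdv1]; omega
      · rw [hdvl]; have := hγlt l; omega
  have h0 : (Sv l₀.succ.succ).det ≠ 0 := by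
    show (Matrix.vecCons C (Matrix.vecCons J P) l₀.succ.succ).det ≠ 0
    simp only [Matrix.cons_val_succ]; exact hbot.det_pos.ne'
  have h2 : (Sv 0).det ≠ 0 := by
    show (Matrix.vecCons C (Matrix.vecCons J P) 0).det ≠ 0
    simp only [Matrix.cons_val_zero]; exact hC.det_pos.ne'
  let negType : ℝ → Prop := fun t => ∀ u : Fin m → ℝ, (∑ k, t ^ dv k • Sv k) *ᵥ u = 0 → u ≠ 0 →
    (derivative (∑ k, Polynomial.C (u ⬝ᵥ (Sv k *ᵥ u)) * (X : ℝ[X]) ^ dv k)).eval t < 0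
  obtain ⟨hidx, -, hsum⟩ := Inertia.global_index_formula dv Sv hS l₀.succ.succ 0 hmin hmax h0 h2 htype negType
    (fun t _ _ => Iff.rfl)
  have hνbot : Fintype.card {j // (Inertia.isHermitian_of_isSymm (hS l₀.succ.succ)).eigenvalues j < 0} = 0 := by
    rw [Fintype.card_eq_zero_iff]
    refine ⟨fun ⟨j, hj⟩ => ?_⟩
    have hbot' : (Sv l₀.succ.succ).PosDef := by
      show (Matrix.vecCons C (Matrix.vecCons J P) l₀.succ.succ).PosDef
      simp only [Matrix.cons_val_succ]; exact hbot
    have hp : 0 < (Inertia.isHermitian_of_isSymm (hS l₀.succ.succ)).eigenvalues j := hbot'.eigenvalues_pos j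
    linarith
  have hνtop : Fintype.card {j // (Inertia.isHermitian_of_isSymm (hS 0)).eigenvalues j < 0} = 0 := by
    rw [Fintype.card_eq_zero_iff]
    refine ⟨fun ⟨j, hj⟩ => ?_⟩
    have hC' : (Sv 0).PosDef := by
      show (Matrix.vecCons C (Matrix.vecCons J P) 0).PosDef
      simp only [Matrix.cons_val_zero]; exact hC
    have hp : 0 < (Inertia.isHermitian_of_isSymm (hS 0)).eigenvalues j := hC'.eigenvalues_pos j
    linarith
  rw [hνbot, hνtop, zero_add, zero_add] at hidx
  set Pd := Matrix.det (∑ k, ((X : ℝ[X]) ^ dv k) • (Sv k).map Polynomial.C) with hPd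
  have hdef : ∀ t : ℝ, 0 < t → (∑ k, t ^ dv k • Sv k).det = 0 → ∀ v : Fin m → ℝ, (∑ k, t ^ dv k • Sv k) *ᵥ v = 0 →
      v ≠ 0 → (derivative (∑ k, Polynomial.C (v ⬝ᵥ (Sv k *ᵥ v)) * (X : ℝ[X]) ^ dv k)).eval t ≠ 0 := by
    intro t ht hdet v hv hv0
    rcases htype t ht hdet with h | h
    · exact ne_of_lt (h v hv hv0)
    · exact ne_of_gt (h v hv hv0)
  set qq : ℝ → Prop := fun t => 0 < t ∧ ¬ negType t with hqq
  have hnodup : (Pd.roots.filter qq).Nodup := by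
    rw [Multiset.nodup_iff_count_le_one]
    intro r
    by_cases hqa : qq r
    · rw [Multiset.count_filter_of_pos hqa, count_roots]
      by_cases hr : (∑ k, r ^ dv k • Sv k).det = 0
      · have h1 := Multiplicity.rootMultiplicity_det_pencil_eq_one dv Sv hS r
          (by rw [Fintype.card_fin]; exact hcorank r hqa.1 hr) (hdef r hqa.1 hr)
        rw [← hPd] at h1
        omega
      · have hnr : ¬ Pd.IsRoot r := by
          intro hroot
          apply hr
          have h1 : Pd.eval r = 0 := hroot
          rwa [hPd, DefiniteMoments.eval_det_pencil] at h1
        rw [Polynomial.rootMultiplicity_eq_zero hnr]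
        exact zero_le_one
    · rw [Multiset.count_filter_of_neg hqa]
      exact zero_le_one
  set T := (Pd.roots.filter qq).toFinset with hTdef
  have hTcard : T.card = Multiset.card (Pd.roots.filter qq) := Multiset.toFinset_card_of_nodup hnodup
  have hTpos : ∀ t ∈ T, 0 < t := fun t ht => (Multiset.mem_filter.mp (Multiset.mem_toFinset.mp ht)).2.1
  have hTroot : ∀ t ∈ T, ∃ u : Fin m → ℝ, (∑ k, t ^ (dv k) • (Sv k)) *ᵥ u = 0 ∧
      0 < (derivative (∑ k, Polynomial.C (u ⬝ᵥ ((Sv k) *ᵥ u)) * (X : ℝ[X]) ^ (dv k))).eval t := by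
    intro t ht
    obtain ⟨hmem, htq⟩ := Multiset.mem_filter.mp (Multiset.mem_toFinset.mp ht)
    obtain ⟨hP0, hroot⟩ := (Polynomial.mem_roots').mp hmem
    have hdet : (∑ k, t ^ dv k • Sv k).det = 0 := by
      have h1 : Pd.eval t = 0 := hroot
      rwa [hPd, DefiniteMoments.eval_det_pencil] at h1
    obtain ⟨u, hu0, hu⟩ := Matrix.exists_mulVec_eq_zero_iff.mpr hdet
    refine ⟨u, hu, ?_⟩
    rcases htype t htq.1 hdet with hneg | hposT
    · exact absurd hneg htq.2
    · exact hposT u hu hu0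
  have hTle : T.card ≤ C.rank + ∑ l, q l * (P l).rank :=
    card_posType_roots_le_commensurable_lower C J P hC.posSemidef hJ hP d₀ a b γ q hb hq hγ T hTpos hTroot
  have hCm : C.rank ≤ m := (Matrix.rank_le_width C).trans le_rfl
  have hPm : ∀ l, (P l).rank ≤ m := fun l => (Matrix.rank_le_width (P l)).trans le_rfl
  have hsumle : ∑ l, q l * (P l).rank ≤ m * ∑ l, q l := by
    rw [Finset.mul_sum]
    exact Finset.sum_le_sum fun l _ => by
      calc q l * (P l).rank ≤ q l * m := Nat.mul_le_mul_left _ (hPm l)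
        _ = m * q l := Nat.mul_comm _ _
  rw [← hsum]
  have hN : Multiset.card (Pd.roots.filter qq) ≤ m + m * ∑ l, q l := by
    rw [← hTcard]; exact hTle.trans (Nat.add_le_add hCm hsumle)
  have hidx' : Multiset.card (Pd.roots.filter fun t => 0 < t ∧ negType t) = Multiset.card (Pd.roots.filter qq) :=
    hidx.symm
  rw [hidx']
  omega

end CommensurableLowerCensus

end TwoSidedThree

end Summit.ValiantsHypothesis.ValiantsHypothesis.Theorems.KPlusLogSqLaw.TowerGraft
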